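import Literature.Analysis.SegalBargmann.HermiteCoefficients
import Literature.Analysis.SegalBargmann.FockHermiteL2
import Mathlib.MeasureTheory.Measure.Haar.InnerProductSpace
import HarnessLib

/-!
# The uniform bound on Hermite coefficients and their rapid decay (Folland 1989, §1.7 (vii))

Topic `Analysis/SegalBargmann`; namespace `Literature.Analysis.SegalBargmann`.  Continuation of
`Literature.Analysis.SegalBargmann.HermiteCoefficients`, joined with the tree's orthonormality of the Hermite
functions (`FockHermiteL2.hermite_norm_sq`, on `σ → ℝ`), transported to `EuclideanSpace ℝ σ` by the
volume-preserving identification `PiLp.volume_preserving_ofLp`: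

* §1 `integral_norm_sq_hermiteSchwartz_herm : ∫ ‖h_α‖² = 1` on `EuclideanSpace ℝ σ`;
* §2 the Cauchy–Schwarz bound `‖hermiteCoeff α g‖ ≤ √(∫ ‖g‖²)` (uniform in `α`);
* §3 RAPID DECAY with an explicit constant: `|α|^k · ‖hermiteCoeff α f‖ ≤ √(∫ ‖N^k f‖²)` for every `k`
  (`HermiteCoefficients.hermiteCoeff_numberOpCLM_pow` + §2), i.e. the Hermite coefficients of a Schwartz function
  decay faster than every polynomial in `|α|`, with the `L²` norms of the Schwartz functions `N^k f` as constants
  (one half of the `N`-representation theorem for `𝒮(ℝⁿ)`, Reed–Simon I Thm V.13; the converse is NOT here).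

Everything is proved from Mathlib and the imported tree files; no cited fact is used as a hypothesis.

## References

* G. B. Folland, *Harmonic Analysis in Phase Space*, Annals of Mathematics Studies 122, Princeton UP (1989), §1.7 (vii)
  (`{h_α}` orthonormal).  [cite: Folland1989, §1.7]
* M. Reed, B. Simon, *Methods of Modern Mathematical Physics I*, Appendix to §V.3 (the `N`-representation of `𝒮`).

## Provenance

Written for the tree under the LEAN-IN-TREE rule (2026-08-18) by the pub-hodgecm formalisation cell (model-construction
sub-cell, seat mc-binder-2).
-/

set_option autoImplicit false

noncomputable section

open MvPolynomial Complex SchwartzMap MeasureTheory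
open scoped BigOperators Real

namespace Literature.Analysis.SegalBargmann

variable {σ : Type*} [Fintype σ] [DecidableEq σ]

/-! ## §1  `∫ ‖h_α‖² = 1` on `EuclideanSpace ℝ σ` -/

section NormSq

omit [DecidableEq σ] in
/-- Transport of integrals along the volume-preserving identification `EuclideanSpace ℝ σ → (σ → ℝ)`
(Mathlib `PiLp.volume_preserving_ofLp`). [folklore] -/
theorem integral_euclidean_eq_integral_pi {G : Type*} [NormedAddCommGroup G] [NormedSpace ℝ G]
    (F : (σ → ℝ) → G) :
    ∫ x : EuclideanSpace ℝ σ, F (⇑x) = ∫ y : σ → ℝ, F y :=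
  (PiLp.volume_preserving_ofLp σ).integral_comp (MeasurableEquiv.toLp 2 (σ → ℝ)).symm.measurableEmbedding F

/-- **`‖h_α‖_{L²(ℝ^σ)} = 1`** on `EuclideanSpace ℝ σ`: `∫ ‖hermiteSchwartz (herm α) x‖² dx = 1` (the tree's
`hermite_norm_sq`, transported). [cite: Folland1989, §1.7] -/
theorem integral_norm_sq_hermiteSchwartz_herm (α : σ →₀ ℕ) :
    ∫ x : EuclideanSpace ℝ σ, ‖hermiteSchwartz (herm α) x‖ ^ 2 = 1 := by
  have h1 : ∫ x : EuclideanSpace ℝ σ, ‖hermiteSchwartz (herm α) x‖ ^ 2 =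
      ∫ y : σ → ℝ, ‖hermiteFun (herm α) y‖ ^ 2 := by
    simp_rw [hermiteSchwartz_apply]
    exact integral_euclidean_eq_integral_pi (fun y => ‖hermiteFun (herm α) y‖ ^ 2)
  have h2 : ((∫ y : σ → ℝ, ‖hermiteFun (herm α) y‖ ^ 2 : ℝ) : ℂ) = 1 := by
    rw [← hermite_norm_sq α, ← integral_complex_ofReal]
    refine integral_congr_ae (Filter.Eventually.of_forall fun y => ?_)
    show ((‖hermiteFun (herm α) y‖ ^ 2 : ℝ) : ℂ) = hermiteFun (herm α) y * (starRingEnd ℂ) (hermiteFun (herm α) y)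
    rw [Complex.mul_conj, Complex.normSq_eq_norm_sq, Complex.ofReal_pow]
  rw [h1]
  exact_mod_cast h2

end NormSq

/-! ## §2  The Cauchy–Schwarz bound `‖c_α(g)‖ ≤ ‖g‖_{L²}` -/

section Bound

omit [DecidableEq σ] in
/-- `x ↦ ‖g x‖` is in `L²` for a Schwartz function `g` (Mathlib `SchwartzMap.memLp`). [folklore] -/
theorem memLp_two_norm (g : 𝓢(EuclideanSpace ℝ σ, ℂ)) :
    MemLp (fun x : EuclideanSpace ℝ σ => ‖g x‖) (ENNReal.ofReal 2) volume := by
  rw [show ENNReal.ofReal 2 = (2 : ENNReal) by norm_num]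
  exact (g.memLp 2).norm

/-- **`‖hermiteCoeff α g‖ ≤ √(∫ ‖g‖²)`**, uniformly in `α` (Cauchy–Schwarz and `‖h_α‖_{L²} = 1`).
[cite: Folland1989, §1.7] -/
theorem norm_hermiteCoeff_le (α : σ →₀ ℕ) (g : 𝓢(EuclideanSpace ℝ σ, ℂ)) :
    ‖hermiteCoeff α g‖ ≤ Real.sqrt (∫ x : EuclideanSpace ℝ σ, ‖g x‖ ^ 2) := by
  rw [hermiteCoeff_apply]
  have hCS := integral_mul_le_Lp_mul_Lq_of_nonneg (μ := (volume : Measure (EuclideanSpace ℝ σ)))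
    Real.HolderConjugate.two_two
    (Filter.Eventually.of_forall fun x => norm_nonneg (hermiteSchwartz (herm α) x))
    (Filter.Eventually.of_forall fun x => norm_nonneg (g x))
    (memLp_two_norm (hermiteSchwartz (herm α))) (memLp_two_norm g)
  calc ‖∫ x : EuclideanSpace ℝ σ, hermiteSchwartz (herm α) x * g x‖
      ≤ ∫ x : EuclideanSpace ℝ σ, ‖hermiteSchwartz (herm α) x * g x‖ := norm_integral_le_integral_norm _
    _ = ∫ x : EuclideanSpace ℝ σ, ‖hermiteSchwartz (herm α) x‖ * ‖g x‖ := by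
        simp_rw [norm_mul]
    _ ≤ (∫ x : EuclideanSpace ℝ σ, ‖hermiteSchwartz (herm α) x‖ ^ (2 : ℝ)) ^ (1 / (2 : ℝ)) *
          (∫ x : EuclideanSpace ℝ σ, ‖g x‖ ^ (2 : ℝ)) ^ (1 / (2 : ℝ)) := hCS
    _ = Real.sqrt (∫ x : EuclideanSpace ℝ σ, ‖g x‖ ^ 2) := by
        have hh : ∫ x : EuclideanSpace ℝ σ, ‖hermiteSchwartz (herm α) x‖ ^ (2 : ℝ) = 1 := by
          simp_rw [Real.rpow_two]
          exact integral_norm_sq_hermiteSchwartz_herm α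
        simp_rw [hh, Real.one_rpow, one_mul, Real.rpow_two, Real.sqrt_eq_rpow]

end Bound

/-! ## §3  Rapid decay with explicit constants -/

section Decay

/-- **Rapid decay of the Hermite coefficients of a Schwartz function**: for every `k`,
`|α|^k · ‖c_α(f)‖ ≤ ‖N^k f‖_{L²} = √(∫ ‖(N^k f)(x)‖² dx)`, where `N` is the number operator of `HermiteOscillator`
(a continuous operator on `𝓢(ℝ^σ, ℂ)`, so `N^k f` is again Schwartz and the right-hand side is a finite constant
depending on `f` and `k` only). [cite: Folland1989, §1.7] -/
theorem degree_pow_mul_norm_hermiteCoeff_le (α : σ →₀ ℕ) (k : ℕ) (f : 𝓢(EuclideanSpace ℝ σ, ℂ)) :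
    (α.degree : ℝ) ^ k * ‖hermiteCoeff α f‖ ≤
      Real.sqrt (∫ x : EuclideanSpace ℝ σ, ‖((numberOpCLM ^ k) f) x‖ ^ 2) := by
  have h := norm_hermiteCoeff_le α ((numberOpCLM ^ k) f)
  rw [hermiteCoeff_numberOpCLM_pow, norm_mul, norm_pow, Complex.norm_natCast] at h
  exact h

/-- The same as a decay statement: `‖c_α(f)‖ ≤ ‖N^k f‖_{L²} / |α|^k` for `α ≠ 0`. [cite: Folland1989, §1.7] -/
theorem norm_hermiteCoeff_le_div (α : σ →₀ ℕ) (hα : α ≠ 0) (k : ℕ) (f : 𝓢(EuclideanSpace ℝ σ, ℂ)) :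
    ‖hermiteCoeff α f‖ ≤
      Real.sqrt (∫ x : EuclideanSpace ℝ σ, ‖((numberOpCLM ^ k) f) x‖ ^ 2) / (α.degree : ℝ) ^ k := by
  have hdeg : 0 < (α.degree : ℝ) := by
    have : α.degree ≠ 0 := fun h0 => hα ((Finsupp.degree_eq_zero_iff α).mp h0)
    exact_mod_cast Nat.pos_of_ne_zero this
  rw [le_div_iff₀ (pow_pos hdeg k), mul_comm]
  exact degree_pow_mul_norm_hermiteCoeff_le α k f

end Decay

end Literature.Analysis.SegalBargmann

end
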